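import Mathlib.Geometry.Manifold.HasGroupoid
import Mathlib.AlgebraicTopology.FundamentalGroupoid.SimplyConnected
import Literature.AlgebraicTopology.SingularHomology.ExcisionMayerVietoris
import HarnessLib

/-!
# Whitehead–Hurewicz: simply connected acyclic manifolds are contractible (named fact)

Topic `Literature/AlgebraicTopology/Homotopy`. The homological recognition principle for
contractibility, in the generality of topological manifolds:

* G. E. Bredon, *Topology and Geometry*, GTM 139, Springer (1993), Ch. VII, Cor. 10.11 (p. 479):
  "A connected CW-complex `K` is contractible ⇔ `π₁(K) = 1` and `H̃_*(K) = 0`." (Hurewicz's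
  theorem, Cor. 10.10, gives `πᵢ(K) = 0` for all `i`, and the contraction is built skeleton by
  skeleton; equivalently Whitehead's theorem, Bredon VII Thm. 11.2 / Hatcher Thm. 4.5 with
  Cor. 4.33.)
* J. Milnor, *On spaces having the homotopy type of a CW-complex*, Trans. AMS 90 (1959),
  Cor. 1 (p. 272): "Every separable manifold belongs to the class `W₀`" of spaces having the
  homotopy type of a countable CW-complex. (For compact manifolds also Hatcher,
  *Algebraic Topology* (2002), Cor. A.12.)

Since the fundamental group, singular homology and contractibility are invariants of homotopy
type, the two together give the statement vendored here as the named fact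

* `Literature.AlgebraicTopology.Homotopy.Manifold.contractibleSpace_of_simplyConnected_of_acyclic`: a simply connected Hausdorff
  second countable topological `n`-manifold `M` (`ChartedSpace (EuclideanSpace ℝ (Fin n)) M`)
  with `Hₖ(M; ℤ) = 0` for all `k ≥ 1` is contractible.

Mathlib has CW complexes (`Topology.CWComplex`) but neither cellular/CW approximation, nor the
Hurewicz theorem, nor Whitehead's theorem, nor the CW homotopy type of manifolds; the tree's
singular homology library (`Literature/AlgebraicTopology/SingularHomology`) has none of these
either, so the principle is recorded as a named fact (users take
`(h : Manifold.contractibleSpace_of_simplyConnected_of_acyclic)`). Proved here: the (elementary)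
converse `Literature.AlgebraicTopology.Homotopy.Manifold.simplyConnected_and_acyclic_of_contractibleSpace`, and the repackaging
`…of_isOpen` for open subsets of manifolds. First consumer: the contractibility of punctured
homotopy spheres (`Literature.Topology.FourManifolds.HomotopySphere.contractibleSpace_compl_image_ball`,
`Literature/Topology/FourManifolds/HomotopySpheresSum.lean`; Kosinski, *Differential Manifolds*
(1993), VI §1–§2).

## References

* G. E. Bredon, *Topology and Geometry*, GTM 139, Springer (1993), Ch. VII §10, Cor. 10.11;
  §11, Thm. 11.2. [Bredon1993]
* J. Milnor, *On spaces having the homotopy type of a CW-complex*, Trans. Amer. Math. Soc. 90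
  (1959) 272–280, Thm. 1 and Cor. 1. [Milnor1959]
* A. Hatcher, *Algebraic Topology*, CUP (2002), Thm. 4.5, Cor. 4.33, Cor. A.12. [HatcherAT2002]
-/

noncomputable section

open CategoryTheory Limits

universe u

namespace Literature.AlgebraicTopology.Homotopy

namespace Manifold

/-- **Simply connected acyclic manifolds are contractible** (Whitehead–Hurewicz). A connected
CW-complex `K` is contractible iff `π₁(K) = 1` and `H̃_*(K; ℤ) = 0` (Bredon, *Topology and
Geometry* (1993), Ch. VII, Cor. 10.11); every separable — in particular every Hausdorff second
countable — topological manifold has the homotopy type of a countable CW-complex (Milnor 1959,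
Cor. 1); and simple connectivity, singular homology and contractibility are homotopy
invariants. Hence: if `M` is a Hausdorff, second countable topological `n`-manifold
(`ChartedSpace (EuclideanSpace ℝ (Fin n)) M`) which is simply connected (Mathlib's
`SimplyConnectedSpace`, which includes path connectedness and nonemptiness) and whose singular
homology `Hₖ(M; ℤ) = Literature.singularHomology ℤ ℤ M k` vanishes for every `k ≥ 1`, then `M` is
contractible. [cite: Bredon1993, Ch. VII Cor. 10.11] [cite: Milnor1959, Cor. 1] -/
def contractibleSpace_of_simplyConnected_of_acyclic : Prop :=
  ∀ (n : ℕ) (M : Type u) [TopologicalSpace M] [T2Space M] [SecondCountableTopology M]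
    [ChartedSpace (EuclideanSpace ℝ (Fin n)) M] [SimplyConnectedSpace M],
    (∀ k : ℕ, 1 ≤ k → IsZero (SingularHomology.singularHomology ℤ ℤ M k)) → ContractibleSpace M

/-- The elementary converse of `contractibleSpace_of_simplyConnected_of_acyclic`, valid for every
space: a contractible space is simply connected (Mathlib) and has vanishing singular homology in
positive degrees (homotopy invariance and the dimension axiom; Bredon 1993, VII Cor. 10.11 "⇒",
Hatcher 2002, Prop. 2.8). [cite: Bredon1993, Ch. VII Cor. 10.11] -/
theorem simplyConnected_and_acyclic_of_contractibleSpace (M : Type u) [TopologicalSpace M]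
    [ContractibleSpace M] :
    SimplyConnectedSpace M ∧ ∀ k : ℕ, 1 ≤ k → IsZero (SingularHomology.singularHomology ℤ ℤ M k) :=
  ⟨inferInstance, fun _ hk => SingularHomology.isZero_singularHomology_of_contractibleSpace ℤ ℤ (by omega)⟩

/-- `contractibleSpace_of_simplyConnected_of_acyclic` **for open subsets of manifolds**: an open
subset `s` of a Hausdorff second countable topological `n`-manifold is itself such a manifold
(Mathlib's `TopologicalSpace.Opens.instChartedSpace`), so if `↥s` is simply connected with
`Hₖ(s; ℤ) = 0` for `k ≥ 1` then `↥s` is contractible, GIVEN the named fact. [cite: Bredon1993, Ch. VII Cor. 10.11] [cite: Milnor1959, Cor. 1] -/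
theorem contractibleSpace_of_simplyConnected_of_acyclic.of_isOpen
    (h : contractibleSpace_of_simplyConnected_of_acyclic.{u}) (n : ℕ) {M : Type u}
    [TopologicalSpace M] [T2Space M] [SecondCountableTopology M]
    [ChartedSpace (EuclideanSpace ℝ (Fin n)) M] {s : Set M} (hs : IsOpen s)
    [SimplyConnectedSpace s] (hac : ∀ k : ℕ, 1 ≤ k → IsZero (SingularHomology.singularHomology ℤ ℤ s k)) :
    ContractibleSpace s :=
  haveI : ChartedSpace (EuclideanSpace ℝ (Fin n)) s :=
    inferInstanceAs (ChartedSpace (EuclideanSpace ℝ (Fin n)) (⟨s, hs⟩ : TopologicalSpace.Opens M))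
  h n s hac

end Manifold

end Literature.AlgebraicTopology.Homotopy

end
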